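import Summits.BirchSwinnertonDyer.BirchSwinnertonDyer.Theorems.ResidualThetaTransportAtTwoLambdaLowerBoundODual
import Summits.BirchSwinnertonDyer.BirchSwinnertonDyer.Theorems.ResidualThetaTransportAtTwoResidualThetaCountLowerPureAtTwoOfLambdaLower
import Summits.BirchSwinnertonDyer.BirchSwinnertonDyer.Theorems.ResidualThetaTransportAtTwoLambdaLowerBoundOWeierstrass
import Summits.BirchSwinnertonDyer.BirchSwinnertonDyer.Theorems.ResidualThetaTransportAtTwoLambdaLowerBoundOExact
import Summits.BirchSwinnertonDyer.BirchSwinnertonDyer.Theorems.ResidualThetaTransportAtTwoThetaTransportLatticeHomothety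
import Summits.BirchSwinnertonDyer.BirchSwinnertonDyer.Theorems.ResidualThetaTransportAtTwoThetaTransportRankTwoPhiLines
import Summits.BirchSwinnertonDyer.BirchSwinnertonDyer.Theorems.ResidualThetaTransportAtTwoThetaTransportFirstLemmas
import Literature.NumberTheory.EllipticCurves.GreenbergSelmerNewform
import Literature.NumberTheory.EllipticCurves.NewformGaloisRep
import Literature.NumberTheory.EllipticCurves.PadicCoeffIntegersFrobeniusData
import HarnessLib

/-!
# S2 `stub_cmLambdaLower` ⟸ the `𝒪`-corank statement (f): the registered v5 signature of S2 from a
# scalar-stable subgroup of the transported plus-Selmer set with a `Λ_𝒪`-dual of rank `≥ d + Σ_g(S₀)`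

Route `ResidualThetaTransportAtTwo` (RTT), crux (R≥)ᵖ `ResidualThetaCountLowerPureAtTwo`
(stmt-BirchSwinnertonDyer-26074), skeleton of record «bt26-lambda» (`Cruxes/ResidualThetaCountLowerPureAtTwo/Lines/bt26_lambda.lean`,
lead rtt-p2), stub S2 `stub_cmLambdaLower` — v5 registered text (lead g13, `Set.encard` form). Seat `prover-bsd-rtt-w2` g0
(RTT width 2 of director-bsd g13 (195); `--supports`, closes nothing). THEOREMS ONLY; std axioms; S2 is NOT proved here
and BSD is not proved by any of this.

* `pow_le_encard_of_dualPair_of_subset` — the `ℕ∞`/`Set.encard` form (NO finiteness hypothesis) of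
  `LambdaLowerBoundO.pow_le_ncard_of_dualPair_of_subset` (p644952): for a scalar-stable subgroup `Sg ⊆ 𝒮` of
  `H¹(K_∞, A)` with a finitely generated `Λ_𝒪`-dual `X` and `m ≤ rank_𝒪(X/X_tors)`,
  `↑(#(𝒪/ϖ)^m) ≤ {c ∈ 𝒮 | ϖ·c = 0}.encard` (an infinite `ϖ`-torsion has `encard = ⊤`).
* **`cmLambdaLower_of_corank`** — the reduction of S2 to (f) of `LINE-DESIGN-g11.md` §2, stated on the crux's own
  binders: IF for every datum of S2 (`W, g, ι, κ, γ, S₀, Lp, Lm, d, n, ρ, Θ, ϖ` with all the S2 hypotheses) there is an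
  additive subgroup `Sg` of the transported `S₀`-imprimitive plus-Selmer SET `𝒮` (the set-builder of the stub without its
  `ϖ`-torsion clause), stable under the scalars `𝒪 = 𝒪_{ℚ₂(ι K_g)}` (`scalarH1`), together with SOME finitely generated
  `Λ_𝒪`-module `X` Pontryagin-dual to `Sg` (bijective `toDual : X → Hom(Sg, ℚ/ℤ)`, constants acting through `scalarH1`,
  `𝒪`-structure in a scalar tower) of rank `rank_𝒪(X/X_tors) ≥ d + Σ_g(S₀)` — THEN the conclusion of S2 holds, in its
  registered v5 form `↑(#(𝒪/ϖ)^(d+Σ_g(S₀))) ≤ 𝒮[ϖ].encard`, VERBATIM (so `exact cmLambdaLower_of_corank h` closes the stub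
  given `h`). The hypothesis is inhabited-in-shape by `LambdaLowerBoundO.exists_dualPair_of_stable` (the dual of any
  `conj_γ`/scalar-stable `Sg` exists with the required structure); what remains RESEARCH is exactly: the scalar-stability
  of (a large enough subgroup of) `𝒮` at `2` (integral Schur, width w3's (H4)), the finite generation of its dual over
  `Λ_𝒪` (Greenberg), and the rank bound `d + Σ_g(S₀)` (BT26 Thm 2.6 + Kato §12 + the Kobayashi ± port ⊗ 𝒪 at `p = 2` +
  Greenberg–Vatsal imprimitivity).

References: [EmertonPollackWeston2006] §3.1, Thm. 3.1.1; [GreenbergLNM1716] §1, §4; [GreenbergVatsal2000] §2;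
[BurungaleTian2026] Thm. 2.6; [Kobayashi2003] §6–§8.
-/

set_option autoImplicit false
-- the Theorems namespace of this sub repeats the summit name by design (D-0017 nested layout)
set_option linter.dupNamespace false
set_option maxHeartbeats 800000

noncomputable section

open scoped Classical

namespace Summit.BirchSwinnertonDyer.BirchSwinnertonDyer.Theorems.LambdaLowerBoundO

open Literature.NumberTheory.EllipticCurves Literature.NumberTheory.EllipticCurves.GreenbergSelmer
open Literature.NumberTheory.GaloisRepresentations NumberField IsDedekindDomain Field

universe w

/-! ### §1. The `encard` form of the dual-pair bound -/

/-- **`#(𝒪/ϖ)^m ≤ #{c ∈ 𝒮 | ϖ·c = 0}` in `ℕ∞` (`Set.encard`), with NO finiteness hypothesis** — the form of the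
v5 registered signature of S2 `stub_cmLambdaLower` (lead rtt-p2 g13: `↑(q^(d+Σ_g(S₀))) ≤ 𝒮[ϖ].encard`): if the
`ϖ`-torsion of `𝒮` is infinite its `encard` is `⊤`; otherwise `pow_le_ncard_of_dualPair_of_subset`.
[cite: EmertonPollackWeston2006, Thm. 3.1.1] [cite: GreenbergLNM1716, §4 p. 98] -/
theorem pow_le_encard_of_dualPair_of_subset {p : ℕ} [Fact p.Prime] {K : Type} [Field K]
    (S : Set (PadicAlgCl p)) [FiniteDimensional ℚ_[p] (padicCoeffField S)] {n : ℕ}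
    (κ : ZpExtension K p) (ρ : FramedGaloisRep K (padicCoeffIntegers S) n)
    (Sg : AddSubgroup (subgroupH1 κ.kerSubgroup (Cofree ρ (padicCoeffField S))))
    (hscal : ∀ (r : padicCoeffIntegers S) {c : subgroupH1 κ.kerSubgroup (Cofree ρ (padicCoeffField S))},
      c ∈ Sg → scalarH1 κ.kerSubgroup (Cofree ρ (padicCoeffField S)) r c ∈ Sg)
    (𝒮 : Set (subgroupH1 κ.kerSubgroup (Cofree ρ (padicCoeffField S))))
    (hSg : (Sg : Set (subgroupH1 κ.kerSubgroup (Cofree ρ (padicCoeffField S)))) ⊆ 𝒮)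
    (X : Type w) [AddCommGroup X]
    [Module (IwasawaAlgebraO S) X] [Module (padicCoeffIntegers S) X]
    [IsScalarTower (padicCoeffIntegers S) (IwasawaAlgebraO S) X] [Module.Finite (IwasawaAlgebraO S) X]
    (toDual : X →+ (Sg →+ AddCircle (1 : ℚ))) (hbij : Function.Bijective toDual)
    (hC : ∀ (a : padicCoeffIntegers S) (x : X) (s : Sg),
      toDual ((PowerSeries.C a : IwasawaAlgebraO S) • x) s =
        toDual x ⟨scalarH1 κ.kerSubgroup (Cofree ρ (padicCoeffField S)) a s, hscal a s.2⟩)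
    (ϖ : padicCoeffIntegers S) (hϖ : Irreducible ϖ) (m : ℕ)
    (hm : m ≤ Module.finrank (padicCoeffIntegers S) (X ⧸ Submodule.torsion (padicCoeffIntegers S) X)) :
    ((Nat.card (padicCoeffIntegers S ⧸ Ideal.span {ϖ}) ^ m : ℕ) : ℕ∞) ≤
      {c : subgroupH1 κ.kerSubgroup (Cofree ρ (padicCoeffField S)) |
        c ∈ 𝒮 ∧ scalarH1 κ.kerSubgroup (Cofree ρ (padicCoeffField S)) ϖ c = 0}.encard := by
  by_cases hfin : {c : subgroupH1 κ.kerSubgroup (Cofree ρ (padicCoeffField S)) |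
      c ∈ 𝒮 ∧ scalarH1 κ.kerSubgroup (Cofree ρ (padicCoeffField S)) ϖ c = 0}.Finite
  · rw [← hfin.cast_ncard_eq, Nat.cast_le]
    exact pow_le_ncard_of_dualPair_of_subset S κ ρ Sg hscal 𝒮 hSg X toDual hbij hC ϖ hϖ m hm hfin
  · rw [Set.Infinite.encard_eq hfin]
    exact le_top

/-! ### §2. S2 from the corank statement, verbatim on the registered v5 signature -/

/-- **S2 `stub_cmLambdaLower` ⟸ (f).** On the binders of the registered v5 signature of S2 (skeleton «bt26-lambda» of crux
(R≥)ᵖ stmt-BirchSwinnertonDyer-26074): if for every S2 datum there is a scalar-stable additive subgroup `Sg` of the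
transported `S₀`-imprimitive plus-Selmer set `𝒮 ⊆ H¹(ℚ_∞, A_g)` with a finitely generated `Λ_𝒪`-dual `X`
(bijective `toDual : X → Hom(Sg, ℚ/ℤ)`, constants through `scalarH1`, `𝒪`-structure in a scalar tower) of rank
`rank_𝒪(X/X_tors) ≥ d + Σ_g(S₀)`, then `↑(#(𝒪/ϖ)^(d + Σ_g(S₀))) ≤ #𝒮[ϖ]` (`Set.encard`) — the conclusion of S2 verbatim.
Proof: `pow_le_encard_of_dualPair_of_subset` for `𝒪 = 𝒪_{ℚ₂(ι K_g)}` (finite over `ℚ₂` as `K_g/ℚ` is: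
`IsNewform0.finiteDimensional_coeffField_holds`, `GreenbergSelmer.finiteDimensional_padicCoeffField`) and the set identity
`{y | unr ∧ arch ∧ Kummer ∧ ϖy = 0} = {y ∈ 𝒮 | ϖy = 0}`. This is the (g)-assembly of `LINE-DESIGN-g11.md` §2
(«#Sel_g[ϖ] = #(X/ϖX) ≥ q^{rank} ≥ q^{d+Σ_g}»); the research content of S2 is thereby isolated as the corank statement (f)
(EPW Thm. 3.1.1: `λ^alg = dim_k Sel[π]` when `μ^alg = 0`). [cite: EmertonPollackWeston2006, Thm. 3.1.1]
[cite: GreenbergLNM1716, §4 p. 98] [cite: GreenbergVatsal2000, §2 Prop. 2.1] -/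
theorem cmLambdaLower_of_corank
    (hcorank : open Literature.NumberTheory.EllipticCurves GreenbergSelmer GreenbergVatsal2000 Kobayashi2003 ModularForms Rank1Residual Literature.NumberTheory.GaloisRepresentations Literature.NumberTheory.Automorphic IsDedekindDomain NumberField Field Rat.HeightOneSpectrum PowerSeries in ∀ (W : WeierstrassCurve ℚ) [W.IsElliptic] [W.IsGloballyMinimal], ¬ W.HasCM → W.analyticRank = 0 → GoodSS W 2 → W.frobeniusTrace 2 = 0 → W.Δ < 0 → ∀ (M : ℕ) [NeZero M] (g : CuspForm (CongruenceSubgroup.Gamma0 M) 2) (ι : coeffField g →+* PadicAlgCl 2) (Ω : ℂ), Odd M → IsNewform0 g → IsCMForm (liftToGamma1 M 2 g) → cuspCoeff g 2 = 0 → IsCohomologicalPlusPeriod g ι Ω → (∀ ℓ : ℕ, ℓ.Prime → ¬ ℓ ∣ 2 * M * W.conductorNorm ℤ → ‖embCoeff g ι ℓ - (W.frobeniusTrace ℓ : PadicAlgCl 2)‖ < 1) → ∀ (κ : ZpExtension ℚ 2) (γ : absoluteGaloisGroup ℚ), κ.IsCyclotomic → κ.IsTopGenerator γ → IsCyclotomicVariable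 2 γ → ∀ (S₀ : Finset (HeightOneSpectrum (RingOfIntegers ℚ))), (∀ v ∈ S₀, ((2 : ℕ) : RingOfIntegers ℚ) ∉ v.asIdeal) → (∀ v, ¬ W.HasGoodReductionAt v → v ∈ S₀) → (∀ v, natGenerator v ∣ M → v ∈ S₀) → ∀ (Lp Lm : IwasawaAlgebraO (Set.range ι)) (d : ℕ), IsPollackPairK g ι Ω Lp Lm → (∀ k, ‖coeff k (iwasawaOToPowerSeries (Set.range ι) Lm)‖ ≤ ‖coeff d (iwasawaOToPowerSeries (Set.range ι) Lm)‖) → (∀ k < d, ‖coeff k (iwasawaOToPowerSeries (Set.range ι) Lm)‖ < ‖coeff d (iwasawaOToPowerSeries (Set.range ι) Lm)‖) → ∀ (n : ℕ) (ρ : FramedGaloisRep ℚ ↥(padicCoeffIntegers (Set.range ι)) 2) (Θ : ∀ v : HeightOneSpectrum (RingOfIntegers ℚ), ((2 : ℕ) : RingOfIntegers ℚ) ∈ v.asIdeal → (Cofree ρ ↥(padicCoeffField (Set.range ι)) ≃+ (Fin n → ↥(W.geomPrimaryTorsion 2)))), (∀ v, ¬ natGenerator v ∣ 2 * M → ρ.IsUnramifiedAt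 v ∧ ∃ P : Polynomial ↥(padicCoeffIntegers (Set.range ι)), P.map (padicCoeffIntegers (Set.range ι)).subtype = Polynomial.X ^ 2 - Polynomial.C (embCoeff g ι (natGenerator v)) * Polynomial.X + Polynomial.C ((natGenerator v : ℕ) : PadicAlgCl 2) ∧ ρ.HasFrobCharpolyAt v P) → (∀ v hv (δ : absoluteGaloisGroup (v.adicCompletion ℚ)) m i, Θ v hv (resGalOfEmb (closureEmb (K := ℚ) (v.adicCompletion ℚ)) δ • m) i = resGalOfEmb (closureEmb (K := ℚ) (v.adicCompletion ℚ)) δ • Θ v hv m i) → ∀ (ϖ : ↥(padicCoeffIntegers (Set.range ι))), Irreducible ϖ → ∃ (Sg : AddSubgroup (subgroupH1 κ.kerSubgroup (Cofree ρ ↥(padicCoeffField (Set.range ι))))), (↑Sg : Set (subgroupH1 κ.kerSubgroup (Cofree ρ ↥(padicCoeffField (Set.range ι))))) ⊆ {y : subgroupH1 κ.kerSubgroup (Cofree ρ ↥(padicCoeffField (Set.range ι))) | y ∈ unramifiedOutside κ.kerSubgroup (Cofree ρ ↥(padicCoeffField (Set.range ι))) 2 ↑S₀ ∧ (∀ w σ,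 conjH1 κ.kerSubgroup (Cofree ρ ↥(padicCoeffField (Set.range ι))) σ y ∈ infKer κ.kerSubgroup (Cofree ρ ↥(padicCoeffField (Set.range ι))) w) ∧ (∀ v hv σ, ∃ (φ : _) (Q : Fin n → localPoints W (v.adicCompletion ℚ)) (k : ℕ), oneCocycleClass (discreteTopRep ↥κ.kerSubgroup (Cofree ρ ↥(padicCoeffField (Set.range ι)))) φ = conjH1 κ.kerSubgroup (Cofree ρ ↥(padicCoeffField (Set.range ι))) σ y ∧ (∀ i, (2 ^ k) • Q i ∈ ⨆ m : ℕ, signedLocalPoints κ (v.adicCompletion ℚ) W 1 m) ∧ ∀ τ i, pointsMapOfEmb W (closureEmb (K := ℚ) (v.adicCompletion ℚ)) (((Θ v hv (φ.1 (resGalSubgroupOfEmb κ.kerSubgroup (closureEmb (K := ℚ) (v.adicCompletion ℚ)) τ))) i : ↥(W.geomPrimaryTorsion 2)) : W.geomPoints) = (τ : absoluteGaloisGroup (v.adicCompletion ℚ)) • Q i - Q i)} ∧ (∀ (r : ↥(padicCoeffIntegers (Set.range ι))) (c : subgroupH1 κ.kerSubgroup (Cofree ρ ↥(padicCoeffField (Set.range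 ι)))), c ∈ Sg → scalarH1 κ.kerSubgroup (Cofree ρ ↥(padicCoeffField (Set.range ι))) r c ∈ Sg) ∧ ∃ (X : Type) (_ : AddCommGroup X) (_ : Module (IwasawaAlgebraO (Set.range ι)) X) (_ : Module ↥(padicCoeffIntegers (Set.range ι)) X) (_ : IsScalarTower ↥(padicCoeffIntegers (Set.range ι)) (IwasawaAlgebraO (Set.range ι)) X) (_ : Module.Finite (IwasawaAlgebraO (Set.range ι)) X) (toDual : X →+ (↥Sg →+ AddCircle (1 : ℚ))), Function.Bijective toDual ∧ (∀ (a : ↥(padicCoeffIntegers (Set.range ι))) (x : X) (s : ↥Sg) (hs : scalarH1 κ.kerSubgroup (Cofree ρ ↥(padicCoeffField (Set.range ι))) a (s : subgroupH1 κ.kerSubgroup (Cofree ρ ↥(padicCoeffField (Set.range ι)))) ∈ Sg), toDual ((PowerSeries.C a : IwasawaAlgebraO (Set.range ι)) • x) s = toDual x ⟨scalarH1 κ.kerSubgroup (Cofree ρ ↥(padicCoeffField (Set.range ι))) a (s : subgroupH1 κ.kerSubgroup (Cofree ρ ↥(padicCoeffField (Set.range ι)))), hs⟩) ∧ (d + ∑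 v ∈ S₀, 2 ^ padicValNat 2 ((natGenerator v ^ 2 - 1) / 8) * (if natGenerator v ∣ M then (if ‖embCoeff g ι (natGenerator v) - 1‖ < 1 then 1 else 0) else (if ‖embCoeff g ι (natGenerator v)‖ < 1 then 2 else 0))) ≤ Module.finrank ↥(padicCoeffIntegers (Set.range ι)) (X ⧸ Submodule.torsion ↥(padicCoeffIntegers (Set.range ι)) X)) :
    open Literature.NumberTheory.EllipticCurves GreenbergSelmer GreenbergVatsal2000 Kobayashi2003 ModularForms Rank1Residual Literature.NumberTheory.GaloisRepresentations Literature.NumberTheory.Automorphic IsDedekindDomain NumberField Field Rat.HeightOneSpectrum PowerSeries in ∀ (W : WeierstrassCurve ℚ) [W.IsElliptic] [W.IsGloballyMinimal], ¬ W.HasCM → W.analyticRank = 0 → GoodSS W 2 → W.frobeniusTrace 2 = 0 → W.Δ < 0 → ∀ (M : ℕ) [NeZero M] (g : CuspForm (CongruenceSubgroup.Gamma0 M) 2) (ι : coeffField g →+* PadicAlgCl 2) (Ω : ℂ), Odd M → IsNewform0 g → IsCMForm (liftToGamma1 M 2 g) → cuspCoeff g 2 = 0 → IsCohomologicalPlusPeriod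 g ι Ω → (∀ ℓ : ℕ, ℓ.Prime → ¬ ℓ ∣ 2 * M * W.conductorNorm ℤ → ‖embCoeff g ι ℓ - (W.frobeniusTrace ℓ : PadicAlgCl 2)‖ < 1) → ∀ (κ : ZpExtension ℚ 2) (γ : absoluteGaloisGroup ℚ), κ.IsCyclotomic → κ.IsTopGenerator γ → IsCyclotomicVariable 2 γ → ∀ (S₀ : Finset (HeightOneSpectrum (RingOfIntegers ℚ))), (∀ v ∈ S₀, ((2 : ℕ) : RingOfIntegers ℚ) ∉ v.asIdeal) → (∀ v, ¬ W.HasGoodReductionAt v → v ∈ S₀) → (∀ v, natGenerator v ∣ M → v ∈ S₀) → ∀ (Lp Lm : IwasawaAlgebraO (Set.range ι)) (d : ℕ), IsPollackPairK g ι Ω Lp Lm → (∀ k, ‖coeff k (iwasawaOToPowerSeries (Set.range ι) Lm)‖ ≤ ‖coeff d (iwasawaOToPowerSeries (Set.range ι) Lm)‖) → (∀ k < d, ‖coeff k (iwasawaOToPowerSeries (Set.range ι) Lm)‖ < ‖coeff d (iwasawaOToPowerSeries (Set.range ι) Lm)‖) → ∀ (n : ℕ) (ρ : FramedGaloisRep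 ℚ ↥(padicCoeffIntegers (Set.range ι)) 2) (Θ : ∀ v : HeightOneSpectrum (RingOfIntegers ℚ), ((2 : ℕ) : RingOfIntegers ℚ) ∈ v.asIdeal → (Cofree ρ ↥(padicCoeffField (Set.range ι)) ≃+ (Fin n → ↥(W.geomPrimaryTorsion 2)))), (∀ v, ¬ natGenerator v ∣ 2 * M → ρ.IsUnramifiedAt v ∧ ∃ P : Polynomial ↥(padicCoeffIntegers (Set.range ι)), P.map (padicCoeffIntegers (Set.range ι)).subtype = Polynomial.X ^ 2 - Polynomial.C (embCoeff g ι (natGenerator v)) * Polynomial.X + Polynomial.C ((natGenerator v : ℕ) : PadicAlgCl 2) ∧ ρ.HasFrobCharpolyAt v P) → (∀ v hv (δ : absoluteGaloisGroup (v.adicCompletion ℚ)) m i, Θ v hv (resGalOfEmb (closureEmb (K := ℚ) (v.adicCompletion ℚ)) δ • m) i = resGalOfEmb (closureEmb (K := ℚ) (v.adicCompletion ℚ)) δ • Θ v hv m i) → ∀ (ϖ : ↥(padicCoeffIntegers (Set.range ι))), Irreducible ϖ → ((Nat.card (↥(padicCoeffIntegers (Set.range ι)) ⧸ Ideal.span {ϖ})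 ^ (d + ∑ v ∈ S₀, 2 ^ padicValNat 2 ((natGenerator v ^ 2 - 1) / 8) * (if natGenerator v ∣ M then (if ‖embCoeff g ι (natGenerator v) - 1‖ < 1 then 1 else 0) else (if ‖embCoeff g ι (natGenerator v)‖ < 1 then 2 else 0))) : ℕ) : ℕ∞) ≤ {y : subgroupH1 κ.kerSubgroup (Cofree ρ ↥(padicCoeffField (Set.range ι))) | y ∈ unramifiedOutside κ.kerSubgroup (Cofree ρ ↥(padicCoeffField (Set.range ι))) 2 ↑S₀ ∧ (∀ w σ, conjH1 κ.kerSubgroup (Cofree ρ ↥(padicCoeffField (Set.range ι))) σ y ∈ infKer κ.kerSubgroup (Cofree ρ ↥(padicCoeffField (Set.range ι))) w) ∧ (∀ v hv σ, ∃ (φ : _) (Q : Fin n → localPoints W (v.adicCompletion ℚ)) (k : ℕ), oneCocycleClass (discreteTopRep ↥κ.kerSubgroup (Cofree ρ ↥(padicCoeffField (Set.range ι)))) φ = conjH1 κ.kerSubgroup (Cofree ρ ↥(padicCoeffField (Set.range ι))) σ y ∧ (∀ i, (2 ^ k) • Q i ∈ ⨆ m : ℕ, signedLocalPoints κ (v.adicCompletion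 ℚ) W 1 m) ∧ ∀ τ i, pointsMapOfEmb W (closureEmb (K := ℚ) (v.adicCompletion ℚ)) (((Θ v hv (φ.1 (resGalSubgroupOfEmb κ.kerSubgroup (closureEmb (K := ℚ) (v.adicCompletion ℚ)) τ))) i : ↥(W.geomPrimaryTorsion 2)) : W.geomPoints) = (τ : absoluteGaloisGroup (v.adicCompletion ℚ)) • Q i - Q i) ∧ scalarH1 κ.kerSubgroup (Cofree ρ ↥(padicCoeffField (Set.range ι))) ϖ y = 0}.encard := by
  intro W _ _ hCM hr0 hss ha2 hΔ M _ g ι Ω hM hnew hcmf ha2g hΩ hcong κ γ hκ hγ hcyc S₀ hS₀ hbad hMS Lp Lm d hpair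
    hle hlt n ρ Θ hρ hΘ ϖ hϖ
  obtain ⟨Sg, hSg𝒮, hscal, X, iX, iΛ, i𝒪, iT, iF, toDual, hbij, hC, hrank⟩ :=
    hcorank W hCM hr0 hss ha2 hΔ M g ι Ω hM hnew hcmf ha2g hΩ hcong κ γ hκ hγ hcyc S₀ hS₀ hbad hMS Lp Lm d hpair
      hle hlt n ρ Θ hρ hΘ ϖ hϖ
  haveI : FiniteDimensional ℚ (ModularForms.coeffField g) :=
    ModularForms.IsNewform0.finiteDimensional_coeffField_holds hnew
  haveI : FiniteDimensional ℚ_[2] ↥(padicCoeffField (Set.range ι)) :=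
    GreenbergSelmer.finiteDimensional_padicCoeffField ι
  have key := pow_le_encard_of_dualPair_of_subset (Set.range ι) κ ρ Sg (fun r _ hc ↦ hscal r _ hc) _ hSg𝒮 X
    toDual hbij (fun a x s ↦ hC a x s (hscal a _ s.2)) ϖ hϖ _ hrank
  refine le_of_le_of_eq key (congrArg Set.encard (Set.ext fun y ↦ ?_))
  constructor
  · rintro ⟨⟨h1, h2, h3⟩, h4⟩
    exact ⟨h1, h2, h3, h4⟩
  · rintro ⟨h1, h2, h3, h4⟩
    exact ⟨⟨h1, h2, h3⟩, h4⟩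

end Summit.BirchSwinnertonDyer.BirchSwinnertonDyer.Theorems.LambdaLowerBoundO

end
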